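import Summits.KontsevichZagierPeriods.KontsevichZagierPeriods.Theorems.LinRedNormalFormArrangementNormalFormStubRebaseSimpleZeroManyChainSubJanus
import Summits.KontsevichZagierPeriods.KontsevichZagierPeriods.Theorems.LinRedNormalFormArrangementNormalFormStubRebaseSimpleZeroManyChainReflect
import Summits.KontsevichZagierPeriods.KontsevichZagierPeriods.Theorems.LinRedNormalFormArrangementNormalFormStubRebaseSimpleZeroManyChainCone
import Summits.KontsevichZagierPeriods.KontsevichZagierPeriods.Theorems.LinRedNormalFormArrangementNormalFormStubRebaseSimpleZeroManyChainBlow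
import Summits.KontsevichZagierPeriods.KontsevichZagierPeriods.Theorems.LinRedNormalFormArrangementNormalFormStubRebaseSimpleZeroNestedPinch

/-!
# Stub `stub_rebaseSimpleZeroMany`, part `rebaseSimpleZeroMany_common` (crux `ArrangementNormalForm`,
line `janus-bands`) — brick `ChainPinchU`

A clean chain `A(y) < t₀ < ⋯ < tₙ < B(y)` of `n + 1` fibres (constant letters, simple base pole,
`RebaseChain.IsChain`) over a short base cell inside `{0 < ε₁ (y − y₀) < ε}` at a PINCH END `y₀`
whose bounds pass through the vertex `(y₀, t₀)` and OPEN UPWARDS (`0 < ε₁ A' ≤ ε₁ B'`) is good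
for `GG 0 2 (n + 1)` in each of the three sub-cases (the `K`-fibre version of brick
`NestedPinchU`):
* `IsChain.good_pinch_free` — no letter at the vertex level `t₀` near `(t₀, B)`: sub-section
  Janus at the constant `t₀` (`RebaseChain.good_subJanus`), the box `{t₀ < tₗ < B}` converging by
  the `K`-fibre CONE ESTIMATE `RebaseChain.integrableOn_coneK` (`|f| ≤ C/|y − y₀|`,
  `RebaseChain.abs_glitB`);
* `IsChain.good_pinch_super` — letters at `t₀` allowed, base pole AWAY from `y₀`: reflect the
  chain (`IsChain.reflect`: `−B < −tₙ < ⋯ < −t₀ < −A`), then sub-section Janus at the constant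
  `−T` (i.e. the super-section Janus at `T ≥ B`), the box `{A < tₗ < T}` converging by the
  `K`-fibre LOG-CONE ESTIMATE `RebaseChain.integrableOn_logConeK`;
* `IsChain.good_pinch_blow` — base pole AT `y₀` and some letter at `t₀`: the `Z`-chart blow-up
  `IsChain.good_blowZ` when ALL letters sit at `t₀`; the remaining MIXED configuration (some
  letter at `t₀`, some letter elsewhere; it needs `n + 1 ≥ 3` fibres to converge, e.g.
  `[{0<y<1, y<t₀<t₁<t₂<2y}, 1/(y t₀ (t₂ − 7))]`) is the explicit hypothesis
  `RebaseChain.PinchMixed n`.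
Registered: `rebaseSimpleZeroMany_chainPinchFree`.

References: M. Kontsevich, D. Zagier, *Periods* (2001), §1.2, rules (1a), (2).
-/

noncomputable section

open Set MeasureTheory MvPolynomial
open Literature.NumberTheory.Transcendental Literature.ModelTheory.ExponentialFields

namespace Summit.KontsevichZagierPeriods.ArrangementNormalForm.JanusBands

namespace RebaseChain

open SeparatePos RebasePos RebaseZero RebaseNest

variable {n : ℕ}

/-! ### The mixed pinch configuration -/

/-- **The mixed pinch-vertex configuration** (explicit hypothesis of the common-slope chain
dissection). A clean chain of `n + 1` fibres over a base cell which is exactly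
`{0 < ε₁ (y − y₀) < ε}`, whose bounds pass through the vertex `(y₀, t₀)` and open strictly
upwards (`0 < ε₁ A' < ε₁ B'`), whose simple base pole sits AT `y₀`, with SOME constant letter at
the vertex level `t₀` and SOME constant letter at another level, is good for `GG 0 2 (n + 1)`.
This is a HYPOTHESIS of the dissection, not a proved move: for `n + 1 = 2` it is worker W4's
second blow-up chart (rule 2 over the radial slope as new base); for `n + 1 ≥ 3` with a
letter-free fibre every blow-up chart leaves a power of the radial coordinate in the numerator,
i.e. lands over a two-dimensional base. [Kontsevich–Zagier 2001, §1.2, rule (2)] -/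
def PinchMixed (n : ℕ) : Prop :=
  ∀ (m' : ℕ) (s : KZ.IntegralRep (0 + 1 + (n + 1))) (M : Fin m' → Cf) (A Bd : Cf) (T : BData)
    (p : MvPolynomial (Fin 0) ℚ) (a : Fin (n + 1) → Option Cf) (y₀ t₀ ε₁ ε : ℚ),
    IsChain s M A Bd T p a → (ε₁ = 1 ∨ ε₁ = -1) → 0 < ε →
    (∀ y : ℝ, y ∈ cell M ↔ 0 < (ε₁ : ℝ) * (y - y₀) ∧ (ε₁ : ℝ) * (y - y₀) < ε) →
    A.1 (Fin.last 0) * y₀ + A.2 = t₀ → Bd.1 (Fin.last 0) * y₀ + Bd.2 = t₀ →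
    0 < ε₁ * A.1 (Fin.last 0) → ε₁ * A.1 (Fin.last 0) < ε₁ * Bd.1 (Fin.last 0) → T.ℓ₂.2 = y₀ →
    (∃ l c, a l = some c ∧ c.2 = t₀) → (∃ l c, a l = some c ∧ c.2 ≠ t₀) → Good (n + 1) (KZ.of s)

/-! ### The size of the literal integrand -/

/-- The absolute value of the literal integrand with constant letters, factor by factor.
[folklore] -/
theorem abs_glitB {T : BData} (p : MvPolynomial (Fin 0) ℚ) (a : Fin (n + 1) → Option Cf)
    (ha0 : ∀ l c, a l = some c → c.1 (Fin.last 0) = 0) (z : Fin (0 + 1 + (n + 1)) → ℝ) :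
    |glitB T p a z| = |((p.coeff 0 : ℚ) : ℝ) / ∏ j, ((T.L j).2 : ℝ) ^ T.e j| *
      (|yv z - T.ℓ₁.2| ^ T.n₁ / |yv z - T.ℓ₂.2| ^ T.n₂) *
      ∏ l, (a l).elim (1 : ℝ) fun c => 1 / |tv z l - c.2| := by
  rw [glitB, glit_b0, abs_mul, abs_mul, abs_div (_ ^ _), abs_pow, abs_pow, Finset.abs_prod]
  congr 1
  refine Finset.prod_congr rfl fun l _ => ?_
  rcases hal : a l with _ | c
  · simp
  · simp only [Option.elim_some]
    rw [ev_of_fst_eq_zero (ha0 l c hal), abs_div, abs_one]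

/-- A product over the lettered fibres with factors in `[0, X]`, `X ≥ 1`, is at most `X^{n+1}`.
[folklore] -/
theorem prod_elim_le_pow (a : Fin (n + 1) → Option Cf) (g : Fin (n + 1) → Cf → ℝ) {X : ℝ} (hX : 1 ≤ X)
    (hg0 : ∀ l c, a l = some c → 0 ≤ g l c) (hg : ∀ l c, a l = some c → g l c ≤ X) :
    ∏ l, (a l).elim (1 : ℝ) (g l) ≤ X ^ (n + 1) := by
  have h0 : ∀ l, 0 ≤ (a l).elim (1 : ℝ) (g l) := fun l => by
    rcases hal : a l with _ | c
    · exact zero_le_one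
    · exact hg0 l c hal
  have h1 : ∀ l, (a l).elim (1 : ℝ) (g l) ≤ X := fun l => by
    rcases hal : a l with _ | c
    · exact hX
    · exact hg l c hal
  calc ∏ l, (a l).elim (1 : ℝ) (g l) ≤ ∏ _l : Fin (n + 1), X :=
        Finset.prod_le_prod (fun l _ => h0 l) fun l _ => h1 l
    _ = X ^ (n + 1) := by rw [Finset.prod_const, Finset.card_univ, Fintype.card_fin]

/-- A product over the lettered fibres with nonnegative factors, those outside `S` in `[0, X]`
(`X ≥ 1`), is at most `X^{n+1}` times the product over `S`. [folklore] -/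
theorem prod_elim_le_pow_mul (S : Finset (Fin (n + 1))) (a : Fin (n + 1) → Option Cf)
    (g : Fin (n + 1) → Cf → ℝ) {X : ℝ} (hX : 1 ≤ X) (hg0 : ∀ l c, a l = some c → 0 ≤ g l c)
    (hg : ∀ l c, l ∉ S → a l = some c → g l c ≤ X) :
    ∏ l, (a l).elim (1 : ℝ) (g l) ≤ X ^ (n + 1) * ∏ l ∈ S, (a l).elim (1 : ℝ) (g l) := by
  classical
  have h0 : ∀ l, 0 ≤ (a l).elim (1 : ℝ) (g l) := fun l => by
    rcases hal : a l with _ | c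
    · exact zero_le_one
    · exact hg0 l c hal
  have h1 : ∀ l ∈ Sᶜ, (a l).elim (1 : ℝ) (g l) ≤ X := fun l hl => by
    rw [Finset.mem_compl] at hl
    rcases hal : a l with _ | c
    · exact hX
    · exact hg l c hl hal
  have hc : ∏ l ∈ Sᶜ, (a l).elim (1 : ℝ) (g l) ≤ X ^ (n + 1) :=
    calc ∏ l ∈ Sᶜ, (a l).elim (1 : ℝ) (g l) ≤ ∏ _l ∈ Sᶜ, X :=
          Finset.prod_le_prod (fun l _ => h0 l) h1
      _ = X ^ Sᶜ.card := Finset.prod_const X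
      _ ≤ X ^ (n + 1) := by
          refine pow_le_pow_right₀ hX ?_
          have := Sᶜ.card_le_univ; rwa [Fintype.card_fin] at this
  rw [← Finset.prod_mul_prod_compl S, mul_comm]
  exact mul_le_mul_of_nonneg_right hc (Finset.prod_nonneg fun l _ => h0 l)

/-! ### The geometry of an upward-opening pinch end -/

variable {m' : ℕ} {s : KZ.IntegralRep (0 + 1 + (n + 1))} {M : Fin m' → Cf} {A Bd : Cf} {T : BData}
  {p : MvPolynomial (Fin 0) ℚ} {a : Fin (n + 1) → Option Cf}

/-- The bounds of an upward-opening pinch end along the short cell: `A = t₀ + ε₁ A' |y − y₀|`,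
`B = t₀ + ε₁ B' |y − y₀|`, `0 < |y − y₀| < ε`. [folklore] -/
theorem pinch_key {y₀ t₀ ε₁ ε : ℚ} (hε₁ : ε₁ = 1 ∨ ε₁ = -1)
    (hA0 : A.1 (Fin.last 0) * y₀ + A.2 = t₀) (hB0 : Bd.1 (Fin.last 0) * y₀ + Bd.2 = t₀)
    (hcell : ∀ y ∈ cell M, 0 < (ε₁ : ℝ) * (y - y₀) ∧ (ε₁ : ℝ) * (y - y₀) < ε) {y : ℝ} (hy : y ∈ cell M) :
    ev A y = t₀ + ε₁ * A.1 (Fin.last 0) * |y - y₀| ∧ ev Bd y = t₀ + ε₁ * Bd.1 (Fin.last 0) * |y - y₀| ∧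
      0 < |y - y₀| ∧ |y - y₀| < ε ∧ |y| ≤ |(y₀ : ℝ)| + ε := by
  obtain ⟨h1, h2⟩ := hcell _ hy
  obtain ⟨eA, habs⟩ := ev_vertex hε₁ hA0 h1
  obtain ⟨eB, -⟩ := ev_vertex hε₁ hB0 h1
  rw [eA, eB, habs]
  refine ⟨rfl, rfl, h1, h2, ?_⟩
  have := abs_add_le (y - y₀) y₀
  rw [sub_add_cancel] at this
  linarith [habs.symm.le]

/-! ### U1: no letter at the vertex level -/

/-- **Pinch above, no letter at `t₀`**: a clean chain over a cell inside
`{0 < ε₁ (y − y₀) < ε}` with bounds through `(y₀, t₀)` opening upwards, base pole not closer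
than `y₀`, letters `η`-far from `(t₀, B)`, is good — sub-section Janus at `t₀`, the box
`{t₀ < tₗ < B}` converging by the `K`-fibre cone estimate.
[Kontsevich–Zagier 2001, §1.2, rules (1), (2)] -/
theorem IsChain.good_pinch_free (hN : IsChain s M A Bd T p a) (y₀ t₀ ε₁ ε η : ℚ)
    (hε₁ : ε₁ = 1 ∨ ε₁ = -1) (hA0 : A.1 (Fin.last 0) * y₀ + A.2 = t₀)
    (hB0 : Bd.1 (Fin.last 0) * y₀ + Bd.2 = t₀) (hα : 0 < ε₁ * A.1 (Fin.last 0))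
    (hαβ : ε₁ * A.1 (Fin.last 0) ≤ ε₁ * Bd.1 (Fin.last 0))
    (hcell : ∀ y ∈ cell M, 0 < (ε₁ : ℝ) * (y - y₀) ∧ (ε₁ : ℝ) * (y - y₀) < ε)
    (hpole : ∀ y ∈ cell M, |y - (y₀ : ℝ)| ≤ |y - T.ℓ₂.2|) (hη : 0 < η)
    (hfar : ∀ l c, a l = some c → ∀ y ∈ cell M, ∀ t : ℝ, (t₀ : ℝ) < t → t < ev Bd y → (η : ℝ) ≤ |t - c.2|) :
    Good (n + 1) (KZ.of s) := by
  have hα' : (0 : ℝ) < ε₁ * A.1 (Fin.last 0) := by exact_mod_cast hα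
  have hαβ' : (ε₁ : ℝ) * A.1 (Fin.last 0) ≤ ε₁ * Bd.1 (Fin.last 0) := by exact_mod_cast hαβ
  have hβ0 : (0 : ℝ) < ε₁ * Bd.1 (Fin.last 0) := hα'.trans_le hαβ'
  have hη' : (0 : ℝ) < η := by exact_mod_cast hη
  have key := fun y hy => pinch_key (M := M) hε₁ hA0 hB0 hcell (y := y) hy
  set T₀ : Cf := RebaseZero.mk 0 t₀ with hT₀def
  have hT₀ : ∀ y, ev T₀ y = t₀ := fun y => by rw [hT₀def, ev_mk, Rat.cast_zero, zero_mul, zero_add]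
  have hTA : ∀ y ∈ cell M, ev T₀ y ≤ ev A y := fun y hy => by
    obtain ⟨eA, -, h0, -⟩ := key y hy
    rw [hT₀, eA]; nlinarith
  have hAB : ∀ y ∈ cell M, ev A y ≤ ev Bd y := fun y hy => by
    obtain ⟨eA, eB, h0, -⟩ := key y hy
    rw [eA, eB]; nlinarith
  have hbox : Bornology.IsBounded (pDom M (fun _ : Fin (n + 1) => T₀) fun _ => Bd) :=
    isBounded_pDom M _ _ fun y hy => (key y hy).2.2.2.2
  have hWm : MeasurableSet (pDom M (fun _ : Fin (n + 1) => T₀) fun _ => Bd) := measurableSet_pDom M _ _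
  -- the cone estimate on the box
  have hW : IntegrableOn (glitB T p a) (pDom M (fun _ : Fin (n + 1) => T₀) fun _ => Bd) := by
    refine integrableOn_coneK (y₀ := y₀) (t₀ := t₀) (β := ε₁ * Bd.1 (Fin.last 0)) (R := ε)
      (C := |((p.coeff 0 : ℚ) : ℝ) / ∏ j, ((T.L j).2 : ℝ) ^ T.e j| * (1 + 1 / η) ^ (n + 1)) hWm
      (KZ.aestronglyMeasurable_of_isSemialgebraicFunOn
        (isSemialgebraicFunOn_glit (isSemialgebraic_pDom M _ _) _ _ _ _ _ _ _ _) hWm)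
      hβ0 (fun z hz => ?_) (fun z hz => ?_)
    · obtain ⟨hy, ht⟩ := (mem_pDom M _ _ z).1 hz
      obtain ⟨-, eB, h0, hε, -⟩ := key _ hy
      refine ⟨⟨h0, hε.le⟩, fun l => ?_⟩
      obtain ⟨h1, h2⟩ := ht l
      rw [hT₀] at h1
      rw [eB] at h2
      rw [abs_of_pos (sub_pos.2 h1)]
      exact ⟨sub_pos.2 h1, by linarith⟩
    · obtain ⟨hy, ht⟩ := (mem_pDom M _ _ z).1 hz
      obtain ⟨-, -, h0, -, -⟩ := key _ hy
      rw [abs_glitB p a hN.a0 z, hN.n1, hN.n2, pow_zero, pow_one]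
      have hK : 0 ≤ |((p.coeff 0 : ℚ) : ℝ) / ∏ j, ((T.L j).2 : ℝ) ^ T.e j| := abs_nonneg _
      have hyr : 1 / |yv z - (T.ℓ₂.2 : ℝ)| ≤ 1 / |yv z - y₀| :=
        one_div_le_one_div_of_le h0 (hpole _ hy)
      have hX : (1 : ℝ) ≤ 1 + 1 / η := by
        have : (0 : ℝ) ≤ 1 / η := by positivity
        linarith
      have hprod : ∏ l, (a l).elim (1 : ℝ) (fun c => 1 / |tv z l - c.2|) ≤ (1 + 1 / η) ^ (n + 1) :=
        prod_elim_le_pow a _ hX (fun l c _ => by positivity) fun l c hc => by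
          obtain ⟨h1, h2⟩ := ht l
          rw [hT₀] at h1
          have hfl := hfar l c hc _ hy _ h1 h2
          calc 1 / |tv z l - c.2| ≤ 1 / (η : ℝ) := one_div_le_one_div_of_le hη' hfl
            _ ≤ 1 + 1 / η := by linarith
      have hP0 : 0 ≤ ∏ l, (a l).elim (1 : ℝ) (fun c => 1 / |tv z l - c.2|) :=
        Finset.prod_nonneg fun l _ => by
          rcases a l with _ | c
          · exact zero_le_one
          · simp only [Option.elim_some]; positivity
      calc _ ≤ |((p.coeff 0 : ℚ) : ℝ) / ∏ j, ((T.L j).2 : ℝ) ^ T.e j| * (1 / |yv z - y₀|) *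
            (1 + 1 / η) ^ (n + 1) :=
            mul_le_mul (mul_le_mul_of_nonneg_left hyr hK) hprod hP0 (by positivity)
        _ = _ := by ring
  exact good_subJanus hTA hAB hW rfl (Or.inl hN.n1) hN.a0 hbox hN.dom hN.int

/-! ### U2: letters at the vertex level, base pole away -/

/-- The letters of the reflected chain are the negated letters in reverse order. [folklore] -/
theorem reflect_letter {l : Fin (n + 1)} {c : Cf} (hc : (a (Fin.rev l)).map Neg.neg = some c) :
    ∃ c₀, a (Fin.rev l) = some c₀ ∧ c = -c₀ := by
  rcases h : a (Fin.rev l) with _ | c₀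
  · rw [h] at hc; cases hc
  · rw [h, Option.map_some, Option.some.injEq] at hc
    exact ⟨c₀, rfl, hc.symm⟩

/-- **Pinch above with letters at `t₀`, base pole away from `y₀`**: a clean chain over a cell
inside `{0 < ε₁ (y − y₀) < ε}` with bounds through `(y₀, t₀)` opening upwards, letters either
AT `t₀` or `η`-far from `(t₀, T)` with `T ≥ t₀ + ε₁ B' ε`, base pole `d`-far, is good —
reflect the chain, then sub-section Janus at `−T` (the super-section Janus at `T`), the box
`{A < tₗ < T}` converging by the `K`-fibre log-cone estimate.
[Kontsevich–Zagier 2001, §1.2, rules (1), (2)] -/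
theorem IsChain.good_pinch_super (hN : IsChain s M A Bd T p a) (y₀ t₀ ε₁ ε Tc η d : ℚ)
    (hε₁ : ε₁ = 1 ∨ ε₁ = -1) (hA0 : A.1 (Fin.last 0) * y₀ + A.2 = t₀)
    (hB0 : Bd.1 (Fin.last 0) * y₀ + Bd.2 = t₀) (hα : 0 < ε₁ * A.1 (Fin.last 0))
    (hαβ : ε₁ * A.1 (Fin.last 0) ≤ ε₁ * Bd.1 (Fin.last 0))
    (hcell : ∀ y ∈ cell M, 0 < (ε₁ : ℝ) * (y - y₀) ∧ (ε₁ : ℝ) * (y - y₀) < ε)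
    (hTc : t₀ + ε₁ * Bd.1 (Fin.last 0) * ε ≤ Tc) (hη : 0 < η)
    (hfar : ∀ l c, a l = some c → c.2 ≠ t₀ → ∀ t : ℝ, (t₀ : ℝ) < t → t < Tc → (η : ℝ) ≤ |t - c.2|)
    (hd : 0 < d) (hpole : ∀ y ∈ cell M, (d : ℝ) ≤ |y - T.ℓ₂.2|) : Good (n + 1) (KZ.of s) := by
  classical
  have hα' : (0 : ℝ) < ε₁ * A.1 (Fin.last 0) := by exact_mod_cast hα
  have hαβ' : (ε₁ : ℝ) * A.1 (Fin.last 0) ≤ ε₁ * Bd.1 (Fin.last 0) := by exact_mod_cast hαβ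
  have hβ0 : (0 : ℝ) ≤ ε₁ * Bd.1 (Fin.last 0) := hα'.le.trans hαβ'
  have hTc' : (t₀ : ℝ) + ε₁ * Bd.1 (Fin.last 0) * ε ≤ Tc := by exact_mod_cast hTc
  have hη' : (0 : ℝ) < η := by exact_mod_cast hη
  have hd' : (0 : ℝ) < d := by exact_mod_cast hd
  have key := fun y hy => pinch_key (M := M) hε₁ hA0 hB0 hcell (y := y) hy
  -- reflect the chain
  obtain ⟨s', hN', hrel⟩ := hN.reflect
  refine RebaseZero.good_of_sub_mem hrel ?_
  set a' : Fin (n + 1) → Option Cf := fun l => (a (Fin.rev l)).map Neg.neg with ha'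
  set p' : MvPolynomial (Fin 0) ℚ := C (pullQ (fun _ : Fin (n + 1) => (-1 : ℚ)) a) * p with hp'
  set T₀ : Cf := RebaseZero.mk 0 (-Tc) with hT₀def
  have hT₀ : ∀ y, ev T₀ y = -Tc := fun y => by
    rw [hT₀def, ev_mk, Rat.cast_zero, zero_mul, zero_add, Rat.cast_neg]
  have hTA : ∀ y ∈ cell M, ev T₀ y ≤ ev (-Bd) y := fun y hy => by
    obtain ⟨-, eB, h0, hε, -⟩ := key y hy
    rw [hT₀, ev_neg, eB]; nlinarith
  have hAB : ∀ y ∈ cell M, ev (-Bd) y ≤ ev (-A) y := fun y hy => by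
    obtain ⟨eA, eB, h0, -, -⟩ := key y hy
    rw [ev_neg, ev_neg, eA, eB]; nlinarith
  have hbox : Bornology.IsBounded (pDom M (fun _ : Fin (n + 1) => T₀) fun _ => -A) :=
    isBounded_pDom M _ _ fun y hy => (key y hy).2.2.2.2
  have hWm : MeasurableSet (pDom M (fun _ : Fin (n + 1) => T₀) fun _ => -A) := measurableSet_pDom M _ _
  -- the vertex fibres of the reflected chain
  set S : Finset (Fin (n + 1)) := Finset.univ.filter fun l => ∃ c, a' l = some c ∧ c.2 = -t₀ with hS
  have hSm : ∀ l, l ∈ S ↔ ∃ c, a' l = some c ∧ c.2 = -t₀ := fun l => by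
    rw [hS, Finset.mem_filter]; exact ⟨fun h => h.2, fun h => ⟨Finset.mem_univ _, h⟩⟩
  -- the log-cone estimate on the box `{−T < sₗ < −A}`
  have hW : IntegrableOn (glitB T p' a') (pDom M (fun _ : Fin (n + 1) => T₀) fun _ => -A) := by
    refine integrableOn_logConeK (y₀ := y₀) (α := ε₁ * A.1 (Fin.last 0)) (R := ε + (Tc - t₀) + 1)
      (c := fun _ => -(t₀ : ℝ))
      (C := |((p'.coeff 0 : ℚ) : ℝ) / ∏ j, ((T.L j).2 : ℝ) ^ T.e j| * (1 / d) * (1 + 1 / η) ^ (n + 1))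
      hWm (KZ.aestronglyMeasurable_of_isSemialgebraicFunOn
        (isSemialgebraicFunOn_glit (isSemialgebraic_pDom M _ _) _ _ _ _ _ _ _ _) hWm)
      S hα' (fun w hw => ?_) (fun w hw => ?_)
    · obtain ⟨hy, ht⟩ := (mem_pDom M _ _ w).1 hw
      obtain ⟨eA, -, h0, hε, -⟩ := key _ hy
      have hl : ∀ l, (ε₁ : ℝ) * A.1 (Fin.last 0) * |yv w - y₀| < -(tv w l + t₀) ∧
          -(tv w l + t₀) < Tc - t₀ := fun l => by
        obtain ⟨h1, h2⟩ := ht l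
        rw [hT₀] at h1
        rw [ev_neg, eA] at h2
        exact ⟨by linarith, by linarith⟩
      have hpos : 0 < (ε₁ : ℝ) * A.1 (Fin.last 0) * |yv w - y₀| := mul_pos hα' h0
      have habs : ∀ l, |tv w l - -(t₀ : ℝ)| = -(tv w l + t₀) := fun l => by
        rw [sub_neg_eq_add, abs_of_neg (by linarith [(hl l).1])]
      have hTt : (0 : ℝ) ≤ Tc - t₀ := by linarith [(hl 0).1, (hl 0).2]
      refine ⟨⟨h0, by linarith⟩, fun l => ?_, fun l _ => ?_⟩
      · rw [habs]
        exact ⟨by linarith [(hl l).1], by linarith [(hl l).2, hε]⟩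
      · rw [habs]; exact (hl l).1.le
    · obtain ⟨hy, ht⟩ := (mem_pDom M _ _ w).1 hw
      obtain ⟨eA, -, h0, -, -⟩ := key _ hy
      rw [abs_glitB p' a' hN'.a0 w, hN'.n1, hN'.n2, pow_zero, pow_one]
      set Kc : ℝ := |((p'.coeff 0 : ℚ) : ℝ) / ∏ j, ((T.L j).2 : ℝ) ^ T.e j| with hKc
      have hK : 0 ≤ Kc := abs_nonneg _
      have hyr : 1 / |yv w - (T.ℓ₂.2 : ℝ)| ≤ 1 / d := one_div_le_one_div_of_le hd' (hpole _ hy)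
      have hX : (1 : ℝ) ≤ 1 + 1 / η := by
        have : (0 : ℝ) ≤ 1 / η := by positivity
        linarith
      -- the letters away from the vertex are `η`-far
      have hprod : ∏ l, (a' l).elim (1 : ℝ) (fun c => 1 / |tv w l - c.2|) ≤
          (1 + 1 / η) ^ (n + 1) * ∏ l ∈ S, (a' l).elim (1 : ℝ) (fun c => 1 / |tv w l - c.2|) :=
        prod_elim_le_pow_mul S a' _ hX (fun l c _ => by positivity) fun l c hl hc => by
          obtain ⟨c₀, hc₀, rfl⟩ := reflect_letter hc
          have hne : c₀.2 ≠ t₀ := fun h => hl ((hSm l).2 ⟨-c₀, hc, by rw [Prod.snd_neg, h]⟩)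
          obtain ⟨h1, h2⟩ := ht l
          rw [hT₀] at h1
          rw [ev_neg, eA] at h2
          have hpos : 0 < (ε₁ : ℝ) * A.1 (Fin.last 0) * |yv w - y₀| := mul_pos hα' h0
          have hfl := hfar (Fin.rev l) c₀ hc₀ hne (-tv w l) (by linarith) (by linarith)
          rw [Prod.snd_neg, Rat.cast_neg, sub_neg_eq_add, show |tv w l + (c₀.2 : ℝ)| = |-tv w l - c₀.2| by
            rw [← abs_neg]; ring_nf]
          calc 1 / |-tv w l - (c₀.2 : ℝ)| ≤ 1 / (η : ℝ) := one_div_le_one_div_of_le hη' hfl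
            _ ≤ 1 + 1 / η := by linarith
      -- the letters at the vertex
      have hSprod : ∏ l ∈ S, (a' l).elim (1 : ℝ) (fun c => 1 / |tv w l - c.2|) =
          ∏ l ∈ S, 1 / |tv w l - -(t₀ : ℝ)| := Finset.prod_congr rfl fun l hl => by
        obtain ⟨c, hc, hct⟩ := (hSm l).1 hl
        rw [hc, Option.elim_some, hct, Rat.cast_neg]
      rw [hSprod] at hprod
      have hP0 : 0 ≤ ∏ l ∈ S, 1 / |tv w l - -(t₀ : ℝ)| := Finset.prod_nonneg fun l _ => by positivity
      calc _ ≤ Kc * (1 / d) * ((1 + 1 / η) ^ (n + 1) * ∏ l ∈ S, 1 / |tv w l - -(t₀ : ℝ)|) :=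
            mul_le_mul (mul_le_mul_of_nonneg_left hyr hK) hprod (Finset.prod_nonneg fun l _ => by
              rcases a' l with _ | c
              · exact zero_le_one
              · simp only [Option.elim_some]; positivity) (by positivity)
        _ = _ := by ring
  exact good_subJanus hTA hAB hW rfl (Or.inl hN'.n1) hN'.a0 hbox hN'.dom hN'.int

/-! ### U3: base pole at `y₀` and a letter at the vertex -/

/-- **Pinch above with the base pole at `y₀` and a letter at `t₀`**: the `Z`-chart blow-up
`IsChain.good_blowZ` if every letter sits at `t₀`, the hypothesis `PinchMixed` otherwise. -/
theorem IsChain.good_pinch_blow (hB : PinchMixed n) (hN : IsChain s M A Bd T p a) (y₀ t₀ ε₁ ε : ℚ)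
    (hε₁ : ε₁ = 1 ∨ ε₁ = -1) (hε : 0 < ε) (hA0 : A.1 (Fin.last 0) * y₀ + A.2 = t₀)
    (hB0 : Bd.1 (Fin.last 0) * y₀ + Bd.2 = t₀) (hα : 0 < ε₁ * A.1 (Fin.last 0))
    (hαβ : ε₁ * A.1 (Fin.last 0) < ε₁ * Bd.1 (Fin.last 0)) (hp : T.ℓ₂.2 = y₀)
    (hat : ∃ l c, a l = some c ∧ c.2 = t₀)
    (hcellI : ∀ y : ℝ, y ∈ cell M ↔ (0 < (ε₁ : ℝ) * (y - y₀) ∧ (ε₁ : ℝ) * (y - y₀) < ε)) :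
    Good (n + 1) (KZ.of s) := by
  by_cases hall : ∀ l c, a l = some c → c.2 = t₀
  · exact hN.good_blowZ y₀ t₀ ε₁ ε hε₁ hcellI hA0 hB0 hp hall
  · push Not at hall
    obtain ⟨l, c, hc, hne⟩ := hall
    exact hB m' s M A Bd T p a y₀ t₀ ε₁ ε hN hε₁ hε hcellI hA0 hB0 hα hαβ hp hat ⟨l, c, hc, hne⟩

end RebaseChain

/-- Registered support goal of this file (part of `rebaseSimpleZeroMany_common`): the upward
pinch end of a clean chain without letters at the vertex level is good
(`RebaseChain.IsChain.good_pinch_free`). -/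
theorem rebaseSimpleZeroMany_chainPinchFree (n m' : ℕ) (s : KZ.IntegralRep (0 + 1 + (n + 1))) (M : Fin m' → (Fin (0 + 1) → ℚ) × ℚ) (A Bd : (Fin (0 + 1) → ℚ) × ℚ) (T : RebaseZero.BData) (p : MvPolynomial (Fin 0) ℚ) (a : Fin (n + 1) → Option ((Fin (0 + 1) → ℚ) × ℚ)) (hN : RebaseChain.IsChain s M A Bd T p a) (y₀ t₀ ε₁ ε η : ℚ) (hε₁ : ε₁ = 1 ∨ ε₁ = -1) (hA0 : A.1 (Fin.last 0) * y₀ + A.2 = t₀) (hB0 : Bd.1 (Fin.last 0) * y₀ + Bd.2 = t₀) (hα : 0 < ε₁ * A.1 (Fin.last 0)) (hαβ : ε₁ * A.1 (Fin.last 0) ≤ ε₁ * Bd.1 (Fin.last 0)) (hcell : ∀ y ∈ RebaseZero.cell M, 0 < (ε₁ : ℝ) * (y - y₀) ∧ (ε₁ : ℝ) * (y - y₀) < ε) (hpole : ∀ y ∈ RebaseZero.cell M, |y - (y₀ : ℝ)| ≤ |y - T.ℓ₂.2|) (hη : 0 < η) (hfar : ∀ l c, a l = some c → ∀ y ∈ RebaseZero.cell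 M, ∀ t : ℝ, (t₀ : ℝ) < t → t < RebaseZero.ev Bd y → (η : ℝ) ≤ |t - c.2|) : RebaseZero.Good (n + 1) (KZ.of s) :=
  hN.good_pinch_free y₀ t₀ ε₁ ε η hε₁ hA0 hB0 hα hαβ hcell hpole hη hfar

end Summit.KontsevichZagierPeriods.ArrangementNormalForm.JanusBands
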